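/-
Copyright (c) 2026 the pub-hodgecm-mathlib formalisation cell (harness21).  Prover seat hodgecm-mathlib-F0P2-p02 (g11): road «S3-tree» (LEAD F0P3a-plan (g11∕g12), architect
A-p16 (g30) rulings A-96 (2) ∕ A-99 (1) «Δ‴ MATCH UNDER THE CAYLEY SHIFT», LIFT `_le_one ↦ _le_two` of the partial head; END F0P3a-p03 (g15)), 2026-09-01.
-/
import Literature.NumberTheory.Rogawski1990.FinExplicitTransferFactorInertPlaceValuation   -- ★ B-p10 (D2): `finExplicitDelta_eq_neg_absNorm_zpow_mul_kappa_of_nonsplit_of_isUnramifiedIn` (`Δ‴ = (−q)^m·κ`)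
import Literature.NumberTheory.Rogawski1990.FinExplicitTransferFactorColumnUnit            -- ★ `finKappaAt_eq_ite_of_eigenvector` (via ★ `…KappaEigenvector`), ★ `finExplicitDelta_conj_{left,right}_all`
import HarnessLib

/-!
# Rogawski's explicit transfer factor under the Cayley shift: `κ_v` is read on a shared eigenvector, and `Δ‴_v(γ_H, γ′) = q_v⁻²·Δ‴_v(u_H, u′)` when the depth sum drops by two
# (Rogawski 1990, §4.9 p. 55, Prop. 4.9.1 (a)(b); §4.3 (4.3.2) p. 43; Kottwitz 1986 §3)

Topic `NumberTheory/Rogawski1990`; namespace `Literature.NumberTheory.Rogawski1990`.  THEOREMS ONLY (no definition, no named fact, no instance, no notation, no `sorry`);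
kernel lane.  Cell `pub/hodgecm-mathlib` (D-0151), crux H413 = `stmt-HodgeConjecture-24833`; road «S3-tree», LIFT `_le_one ↦ _le_two` of the partial head
`localTransferAtOne_of_hyperspecialLevel_le_two` (END F0P3a-p03 (g15); architect A-p16 (g30) A-88 (6)(ii), A-96 (2), A-99 (1): organ (b) «Δ‴ MATCH UNDER THE CAYLEY
SHIFT»; organ (a) «Cayley shift on conjugacy classes» is F0P3a-p06 (g14)'s).  Seat F0P2-p02 (g11); census 2026-09-01T18:55Z (F0∕P3a bus) — with the FINDING that the
match carries the factor `q_v⁻²` (not `1`).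

THE MATHEMATICS.  `v` a finite place of `L⁺` NON-SPLIT and UNRAMIFIED in the CM field `L` (`w ∣ v`, `E_v = L_w`, `q = #k_v`), `μ` unramified at `w` with the N7 guard
`μ|_{𝕀_{L⁺}} = ω_{L∕L⁺}`.  By ★ `finExplicitDelta_eq_neg_absNorm_zpow_mul_kappa_of_nonsplit_of_isUnramifiedIn` (B-p10 (D2)), on a matching pair `ι_v(γ_H) ↔ γ′` with
`χ_g(γ₂)` a unit (every `G`-regular `γ_H`),
  `Δ‴_v(γ_H, γ′) = (−q)^{m(γ_H)} · κ_v(γ_H, γ′)`, `m(γ_H) := log |χ_g(γ₂)_w| = −(n₁₂ + n₂₃)`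
UNIFORMLY in the torus type (no eigenframe, no roots).  In the LIFT, a 2-deep `γ_H` with `G`-side partner `γ′` is replaced by its CAYLEY SHIFT `u_H` (depth sum two less:
`X = 1 + ϖ⁻¹(γ − 1)` divides every eigenvalue difference by `ϖ`, and the Cayley element generates the same order as `X`, ★ `UnitaryLevelTwoInteriorRelabel`) with partner `u′`
(a polynomial in `γ′`, hence with the SAME eigenvectors).  So the two halves of the match are:
* §1 **`κ_v` IS READ ON A SHARED EIGENVECTOR**: if `p′ ≠ 0` is a `γ₂(γ_H)`-eigenvector of `γ′` AND a `γ₂(u_H)`-eigenvector of `u′` (both pairs matching, both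
  `χ`-values units), then `κ_v(γ_H, γ′) = κ_v(u_H, u′)` — both are the unit-norm class of `⟨p′, p′⟩_{H′}` (★ `finKappaAt_eq_ite_of_eigenvector`);
  [Rogawski1990, §4.3 (4.3.2): `κ(inv)` depends only on the eigenline].
* §2 **`Δ‴_v(γ_H, γ′) = q⁻²·Δ‴_v(u_H, u′)`** when moreover `m(u_H) = m(γ_H) + 2` («the depth sum drops by two»): `(−q)^{m} = (−q)^{m+2}·q⁻²`.  The letter spelling
  `((finExplicitCollection L H′ μ …) v).Δ` is the `rfl`-dress `finExplicitCollection_Δ_eq_inv_sq_mul_of_log_eq`.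
CONSEQUENCE (for the END's assembly, A-91 (2)): the interior term of the level-2 orbital sum at `γ_H` is `q⁻²·Σ_{c′} Δ‴_v(u_H, c′)·Φ(c′, g′)`, so the lifted coefficients are
`a(g) = a(h_g) + q⁻²·Sᵀ·a(g′)`, `S = !![1, −q⁻¹; 0, q⁻¹]`.  The non-matching classes (both sides `0`) are organ (a)'s bijection `γ_H ↔ out c ⟺ u_H ↔ out (shift c)`.
HONEST LABEL: HC_CM is proved only modulo the 2 remaining named inputs (hLiu418 24832, h413 24833) until rung 0 closes; nothing printed is asserted here (two rewrites of ★
closed forms); S3 (`stub_N6nsS3id`) stays a print row until the road's END lands.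

## References
* [Rogawski1990] J. D. Rogawski, *Automorphic Representations of Unitary Groups in Three Variables*, Ann. of Math. Stud. 123 (1990), §4.9 p. 55, Prop. 4.9.1 (a)(b); §4.3
  (4.3.2) p. 43; §3.5 Prop. 3.5.2 (c) p. 29; §14.6 p. 242.
* [Kottwitz1986] R. E. Kottwitz, *Base change for unit elements of Hecke algebras*, Compositio Math. 60 (1986), §3 (the shift `γ ↦ 1 + ϖ⁻¹(γ − 1)` on fixed lattices).
* [LanglandsShelstad1987] R. P. Langlands, D. Shelstad, *On the definition of transfer factors*, Math. Ann. 278 (1987), §1 (`inv(γ_H, γ_G)`).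
-/

set_option autoImplicit false

noncomputable section

open NumberField IsDedekindDomain Matrix
open Literature.NumberTheory.GaloisRepresentations
open scoped MatrixGroups

namespace Literature.NumberTheory.Rogawski1990

open Literature.NumberTheory.Automorphic Literature.NumberTheory.Automorphic.UnitaryGroup

variable (L : Type) [Field L] [NumberField L] [IsCMField L] (v : HeightOneSpectrum (𝓞 ↥(maximalRealSubfield L)))
  (H' : Matrix (Fin 3) (Fin 3) L) (w : UnitaryGroup.PlacesOver L v) (hw : IsCMField.complexConj L • w.1 = w.1)

/-! ## §1 `κ_v` on a shared eigenvector -/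

include hw in
open scoped Classical in
/-- **`κ_v` IS READ ON A SHARED EIGENVECTOR** (non-split `v`): for matching pairs `ι_v(γ_H) ↔ γ′`, `ι_v(u_H) ↔ u′` with `χ_g(γ₂)` units, and a non-zero `p′` which is a
`γ₂(γ_H)`-eigenvector of `γ′` and a `γ₂(u_H)`-eigenvector of `u′`: `κ_v(γ_H, γ′) = κ_v(u_H, u′)` — both signs are the unit-norm class of `⟨p′, p′⟩_{H′_v}` (★
`finKappaAt_eq_ite_of_eigenvector`).  This is the `κ`-half of the Δ‴-match under the Cayley shift (`u′ ∈ L_w[γ′]` shares the eigenline of `γ′`).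
[cite: Rogawski1990, §4.3 (4.3.2) p. 43; §3.5 Prop. 3.5.2 (c) p. 29; §14.6 p. 242] [cite: LanglandsShelstad1987, §1] -/
theorem finKappaAt_eq_of_shared_eigenvector
    {γH uH : (UnitaryGroup.cmDatum L 2 (Matrix.of fun i j : Fin 2 => if i.val + j.val + 1 = 2 then (1 : L) else 0)).Local v ×
      (UnitaryGroup.cmDatum L 1 (Matrix.of fun i j : Fin 1 => if i.val + j.val + 1 = 1 then (1 : L) else 0)).Local v}
    {b b' : (UnitaryGroup.cmDatum L 3 H').Local v} (hb : IsLocalNormPair L H' v γH b) (hb' : IsLocalNormPair L H' v uH b')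
    (hu : IsUnit ((finCharpolyTwo L v γH).eval (finGammaTwo L v γH))) (hu' : IsUnit ((finCharpolyTwo L v uH).eval (finGammaTwo L v uH)))
    {p' : Fin 3 → UnitaryGroup.LocalRing L v} (hne : p' ≠ 0)
    (hp : (b.val.val : Matrix (Fin 3) (Fin 3) (UnitaryGroup.LocalRing L v)) *ᵥ p' = finGammaTwo L v γH • p')
    (hp' : (b'.val.val : Matrix (Fin 3) (Fin 3) (UnitaryGroup.LocalRing L v)) *ᵥ p' = finGammaTwo L v uH • p') :
    finKappaAt L v H' γH b = finKappaAt L v H' uH b' := by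
  classical
  have hv : Subsingleton (UnitaryGroup.PlacesOver L v) :=
    UnitaryGroup.PlacesOver.subsingleton_of_smul_eq (IsCMField.complexConj L) (IsCMField.complexConj_ne_one L) w hw
  rw [finKappaAt_eq_ite_of_eigenvector L v H' γH b hv hb hu hp hne, finKappaAt_eq_ite_of_eigenvector L v H' uH b' hv hb' hu' hp' hne]

/-! ## §2 `Δ‴_v` under the shift: the factor `q⁻²` -/

include hw in
open scoped Classical in
/-- **`Δ‴_v(γ_H, γ′) = q⁻²·Δ‴_v(u_H, u′)` WHEN THE DEPTH SUM DROPS BY TWO** (unramified non-split `v`, `μ` unramified at `w` with the N7 guard): for matching pairs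
`ι_v(γ_H) ↔ γ′`, `ι_v(u_H) ↔ u′` with `χ_g(γ₂)` units, a shared eigenvector as in §1, and `log |χ_g(γ₂(u_H))_w| = log |χ_g(γ₂(γ_H))_w| + 2` (the Cayley shift lowers
`n₁₂ + n₂₃` by two): by ★ `finExplicitDelta_eq_neg_absNorm_zpow_mul_kappa_of_nonsplit_of_isUnramifiedIn` both sides are `(−q)^{m}·κ` with the same `κ` (§1) and
exponents `m`, `m + 2`.  `q = Ideal.absNorm v.asIdeal`. [cite: Rogawski1990, §4.9 p. 55, Prop. 4.9.1 (a)(b); §4.3 (4.3.2) p. 43] [cite: Kottwitz1986, §3] -/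
theorem finExplicitDelta_eq_inv_sq_mul_of_log_eq (μ : HeckeCharacter L)
    (hμω : ∀ x : ideleGroup ↥(maximalRealSubfield L), μ (AdeleRing.ideleBaseChange ↥(maximalRealSubfield L) L x) = quadraticHeckeCharCM L x)
    (hunr : Algebra.IsUnramifiedIn (𝓞 L) v.asIdeal) (hμ : μ.IsUnramifiedAt w.1)
    {γH uH : (UnitaryGroup.cmDatum L 2 (Matrix.of fun i j : Fin 2 => if i.val + j.val + 1 = 2 then (1 : L) else 0)).Local v ×
      (UnitaryGroup.cmDatum L 1 (Matrix.of fun i j : Fin 1 => if i.val + j.val + 1 = 1 then (1 : L) else 0)).Local v}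
    {b b' : (UnitaryGroup.cmDatum L 3 H').Local v} (hb : IsLocalNormPair L H' v γH b) (hb' : IsLocalNormPair L H' v uH b')
    (hu : IsUnit ((finCharpolyTwo L v γH).eval (finGammaTwo L v γH))) (hu' : IsUnit ((finCharpolyTwo L v uH).eval (finGammaTwo L v uH)))
    {p' : Fin 3 → UnitaryGroup.LocalRing L v} (hne : p' ≠ 0)
    (hp : (b.val.val : Matrix (Fin 3) (Fin 3) (UnitaryGroup.LocalRing L v)) *ᵥ p' = finGammaTwo L v γH • p')
    (hp' : (b'.val.val : Matrix (Fin 3) (Fin 3) (UnitaryGroup.LocalRing L v)) *ᵥ p' = finGammaTwo L v uH • p')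
    (hm : WithZero.log (Valued.v (((finCharpolyTwo L v uH).eval (finGammaTwo L v uH)) w)) =
      WithZero.log (Valued.v (((finCharpolyTwo L v γH).eval (finGammaTwo L v γH)) w)) + 2) :
    finExplicitDelta L v H' γH μ b = ((Ideal.absNorm v.asIdeal : ℂ) ^ 2)⁻¹ * finExplicitDelta L v H' uH μ b' := by
  classical
  have hq : (Ideal.absNorm v.asIdeal : ℂ) ≠ 0 := by
    have h1 := NumberField.HeightOneSpectrum.one_lt_absNorm v
    exact_mod_cast (show Ideal.absNorm v.asIdeal ≠ 0 by omega)
  rw [finExplicitDelta_eq_neg_absNorm_zpow_mul_kappa_of_nonsplit_of_isUnramifiedIn L v H' γH b w hw μ hμω hunr hμ hb hu,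
    finExplicitDelta_eq_neg_absNorm_zpow_mul_kappa_of_nonsplit_of_isUnramifiedIn L v H' uH b' w hw μ hμω hunr hμ hb' hu', hm,
    finKappaAt_eq_of_shared_eigenvector L v H' w hw hb hb' hu hu' hne hp hp', zpow_add₀ (neg_ne_zero.2 hq)]
  have h2 : (-(Ideal.absNorm v.asIdeal : ℂ)) ^ (2 : ℤ) = (Ideal.absNorm v.asIdeal : ℂ) ^ 2 := by
    rw [zpow_two, pow_two, neg_mul_neg]
  rw [h2, mul_assoc, mul_left_comm (((Ideal.absNorm v.asIdeal : ℂ) ^ 2)⁻¹), ← mul_assoc (((Ideal.absNorm v.asIdeal : ℂ) ^ 2)⁻¹),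
    inv_mul_cancel₀ (pow_ne_zero 2 hq), one_mul]

include hw in
open scoped Classical in
/-- The same in the LETTER SPELLING of the S3-tree heads: `((finExplicitCollection L H′ μ …) v).Δ γ_H γ′ = q⁻² · ((finExplicitCollection L H′ μ …) v).Δ u_H u′` (★
`finExplicitCollection_Δ` is `rfl`). [cite: Rogawski1990, §4.9 p. 55, Prop. 4.9.1 (a)(b)] [cite: Kottwitz1986, §3] -/
theorem finExplicitCollection_Δ_eq_inv_sq_mul_of_log_eq (μ : HeckeCharacter L)
    (hμω : ∀ x : ideleGroup ↥(maximalRealSubfield L), μ (AdeleRing.ideleBaseChange ↥(maximalRealSubfield L) L x) = quadraticHeckeCharCM L x)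
    (hunr : Algebra.IsUnramifiedIn (𝓞 L) v.asIdeal) (hμ : μ.IsUnramifiedAt w.1)
    {γH uH : (UnitaryGroup.cmDatum L 2 (Matrix.of fun i j : Fin 2 => if i.val + j.val + 1 = 2 then (1 : L) else 0)).Local v ×
      (UnitaryGroup.cmDatum L 1 (Matrix.of fun i j : Fin 1 => if i.val + j.val + 1 = 1 then (1 : L) else 0)).Local v}
    {b b' : (UnitaryGroup.cmDatum L 3 H').Local v} (hb : IsLocalNormPair L H' v γH b) (hb' : IsLocalNormPair L H' v uH b')
    (hu : IsUnit ((finCharpolyTwo L v γH).eval (finGammaTwo L v γH))) (hu' : IsUnit ((finCharpolyTwo L v uH).eval (finGammaTwo L v uH)))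
    {p' : Fin 3 → UnitaryGroup.LocalRing L v} (hne : p' ≠ 0)
    (hp : (b.val.val : Matrix (Fin 3) (Fin 3) (UnitaryGroup.LocalRing L v)) *ᵥ p' = finGammaTwo L v γH • p')
    (hp' : (b'.val.val : Matrix (Fin 3) (Fin 3) (UnitaryGroup.LocalRing L v)) *ᵥ p' = finGammaTwo L v uH • p')
    (hm : WithZero.log (Valued.v (((finCharpolyTwo L v uH).eval (finGammaTwo L v uH)) w)) =
      WithZero.log (Valued.v (((finCharpolyTwo L v γH).eval (finGammaTwo L v γH)) w)) + 2) :
    (finExplicitCollection L H' μ (finExplicitDelta_conj_left_all L H' μ) (finExplicitDelta_conj_right_all L H' μ) v).Δ γH b =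
      ((Ideal.absNorm v.asIdeal : ℂ) ^ 2)⁻¹ *
        (finExplicitCollection L H' μ (finExplicitDelta_conj_left_all L H' μ) (finExplicitDelta_conj_right_all L H' μ) v).Δ uH b' := by
  exact finExplicitDelta_eq_inv_sq_mul_of_log_eq L v H' w hw μ hμω hunr hμ hb hb' hu hu' hne hp hp' hm

end Literature.NumberTheory.Rogawski1990

end
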